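import Literature.NumberTheory.EllipticCurves.DivisionFieldRamificationPrimePowProofs
import Literature.NumberTheory.EllipticCurves.DivisionField
import HarnessLib

/-!
# [IUTchIV] Prop. 1.8 (vii) read literally at THE division field `K(E[n])`: unramified at good
# places, ramification index dividing `n` at multiplicative places (`v ∤ n`)

`Proofs` file (theorems only: no definition, no named fact), topic `NumberTheory/EllipticCurves`;
sequel of `DivisionFieldRamificationProofs` (good reduction, `e = 1`) and
`DivisionFieldRamificationPrimePowProofs` (multiplicative reduction, `e ∣ n`), whose headline theorems
are stated for an arbitrary finite Galois `L ⊆ K(E[n])` through the binder `ker ρ̄_{E,n} ≤ Gal(K̄/L)`.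

S. Mochizuki, *Inter-universal Teichmüller theory IV*, Prop. 1.8 (vii), kurims p. 19 speaks of "the
kernel of the action of `G_k` on `E_k[n]`", i.e. of the division field itself.  Here the binder is
DISCHARGED for the tree's `WeierstrassCurve.divisionField W n = K(E[n])` (`DivisionField.lean`: the
fixed field of `Γ_{K(E[n])}`, finite Galois over `K` for `n ≠ 0`), so that both printed sentences hold
verbatim for the primes of `𝓞_{K(E[n])}` — for `E/K` elliptic over a number field, `n` with
`(n : 𝓞 K) ∉ v` (which forces `n ≠ 0`) and a finite place `v`:

* `WeierstrassCurve.ker_galoisRepTorsion_le_fixingSubgroup_divisionField` — `ker ρ̄_{E,n} ≤ Γ_{K(E[n])}`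
  (indeed the kernel of the action fixes `K(E[n])`; `fixingSubgroup_divisionField`);
* `WeierstrassCurve.ramificationIdx_divisionField_self_eq_one_of_hasGoodReductionAt` — **good
  reduction at `v` ⇒ every prime of `𝓞_{K(E[n])}` over `v` has `e = 1`** (first sentence: "the action
  of `G_k` on `E_k[n]` is unramified");
* `WeierstrassCurve.ramificationIdx_divisionField_self_dvd_level_of_hasMultiplicativeReductionAt` —
  **multiplicative reduction at `v` ⇒ every prime of `𝓞_{K(E[n])}` over `v` has `e ∣ n`** (second
  sentence; tameness in Galois form is `DivisionFieldTamenessProofs`).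

The corollary form was pointed out by the RQ7 auditor abc-iut-w5-d173 (kernel probe `ProbeP424600.lean`,
2026-08-26); classical (Silverman *AEC* VII.4.1, *ATAEC* V.4–V.5, Ex. 5.13 (b)); cell abc-iut, campaign S,
node IUTchIV:Prop1.8(vii); nothing here bears on [IUTchIII] Cor. 3.12.

## References

* [SilvermanAEC2009] J. H. Silverman, *The Arithmetic of Elliptic Curves*, 2nd ed. (2009), Prop. VII.4.1,
  VIII.§1.
* [SilvermanATAEC1994] J. H. Silverman, *Advanced Topics in the Arithmetic of Elliptic Curves* (1994),
  V.4–V.5, Exercise 5.13 (b); §IV.10.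
* [Mochizuki2012] S. Mochizuki, *Inter-universal Teichmüller theory IV*, Prop. 1.8 (vii) p. 19.
-/

noncomputable section

open scoped NumberField

open NumberField IsDedekindDomain Field

universe u

namespace WeierstrassCurve

open Literature.NumberTheory.EllipticCurves Literature.NumberTheory.GaloisRepresentations
  IsDedekindDomain.HeightOneSpectrum

variable {K : Type u} [Field K] [NumberField K] (W : WeierstrassCurve K) [W.IsElliptic]

/-- **`ker ρ̄_{E,n} ≤ Γ_{K(E[n])}`**: an element of `Γ_K` acting trivially on `E[n]` fixes the division
field `K(E[n])` (the fixed field of the pointwise fixer of `E[n]`, `fixingSubgroup_divisionField`).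
[cite: SilvermanATAEC1994, §IV.10 (L = K(E[ℓ]), PDF p. 358)] -/
theorem ker_galoisRepTorsion_le_fixingSubgroup_divisionField (n : ℕ) [NeZero n] :
    (W.galoisRepTorsion (n : ℤ)).ker ≤ (W.divisionField n).fixingSubgroup := by
  intro σ hσ
  rw [W.fixingSubgroup_divisionField n, W.mem_fixingSubgroupOfModule_geomTorsion_iff n]
  intro T
  rw [← galoisRepTorsion_apply, MonoidHom.mem_ker.mp hσ]
  rfl

/-- **[IUTchIV] Prop. 1.8 (vii), first sentence, at the division field**: if `E` has good reduction at
`v` and `(n : 𝓞 K) ∉ v`, every prime `Q` of `𝓞_{K(E[n])}` over `v` is unramified, `e(Q ∣ v) = 1`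
("the action of `G_k` on `E_k[n]` is unramified"; Néron–Ogg–Shafarevich, easy half).
[cite: Mochizuki2012, IUTchIV Prop 1.8 (vii) p.19] [cite: SilvermanAEC2009, Prop. VII.4.1] -/
theorem ramificationIdx_divisionField_self_eq_one_of_hasGoodReductionAt {n : ℕ}
    {v : HeightOneSpectrum (𝓞 K)} (hv : W.HasGoodReductionAt v) (hnv : (n : 𝓞 K) ∉ v.asIdeal)
    (Q : Ideal (𝓞 (W.divisionField n))) [Q.IsPrime] [Q.LiesOver v.asIdeal] :
    Q.ramificationIdx (𝓞 K) = 1 := by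
  haveI : NeZero n := ⟨by
    rintro rfl
    exact hnv (by rw [Nat.cast_zero]; exact v.asIdeal.zero_mem)⟩
  exact W.ramificationIdx_divisionField_eq_one_of_hasGoodReductionAt (n := (n : ℤ)) (W.divisionField n)
    (W.ker_galoisRepTorsion_le_fixingSubgroup_divisionField n) hv (by exact_mod_cast hnv) Q

/-- **[IUTchIV] Prop. 1.8 (vii), second sentence, at the division field**: if `E` has multiplicative
reduction at `v` and `(n : 𝓞 K) ∉ v`, every prime `Q` of `𝓞_{K(E[n])}` over `v` has ramification index
DIVIDING `n` (and `K(E[n])/K` is tamely ramified at `v`: `DivisionFieldTamenessProofs`).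
[cite: Mochizuki2012, IUTchIV Prop 1.8 (vii) p.19] [cite: SilvermanATAEC1994, V.4–V.5 and Exercise 5.13 (b)] -/
theorem ramificationIdx_divisionField_self_dvd_level_of_hasMultiplicativeReductionAt {n : ℕ}
    {v : HeightOneSpectrum (𝓞 K)} (hv : W.HasMultiplicativeReductionAt v) (hnv : (n : 𝓞 K) ∉ v.asIdeal)
    (Q : Ideal (𝓞 (W.divisionField n))) [Q.IsPrime] [Q.LiesOver v.asIdeal] :
    Q.ramificationIdx (𝓞 K) ∣ n := by
  haveI : NeZero n := ⟨by
    rintro rfl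
    exact hnv (by rw [Nat.cast_zero]; exact v.asIdeal.zero_mem)⟩
  exact W.ramificationIdx_divisionField_dvd_level_of_hasMultiplicativeReductionAt (W.divisionField n)
    (W.ker_galoisRepTorsion_le_fixingSubgroup_divisionField n) hv hnv Q

end WeierstrassCurve

end
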